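import Summits.SmoothPoincare4.SmoothPoincare4.Theses.EntropyRung
import Literature.Geometry.Lorentzian.FlatChartComputations
import HarnessLib

/-!
# Radial calculus in a flat chart
(crux stmt-SmoothPoincare4-10871 `EntropyRung.SubcylindricalExistence`, line
`fat-conical-core-avr-logsobolev`, helper stub W6 `helper_flatChartRadial` of lead c4's skeleton)

Let `g` be a smooth metric on a smooth `4`-manifold `M` of the summit binder, `p : M`,
`φ = extChartAt (𝓡 4) p` (for the boundaryless model `𝓡 4` this is the chart `chartAt _ p`, a
chart of the maximal atlas), and suppose the inverse chart is a `g`-isometry on the closed ball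
`closedBall (φ p) r ⊆ φ.target`: `g(dφ⁻¹_y X, dφ⁻¹_y W) = ⟪X, W⟫`. If `Φ ∘ φ⁻¹ = ω(‖· − φ p‖²)` on
the open ball for a smooth profile `ω : ℝ → ℝ`, then at `φ⁻¹ y`, `y` in the open ball,
`s = ‖y − φ p‖²`:

* `R_g = 0` (`scalarCurvature_of_flatOn`: constant metric components have vanishing Christoffel
  symbols, O'Neill 1983, Ch. 3, Prop. 3.13 and Lemma 3.38);
* `|∇Φ|²_g = Σᵢ (∂ᵢ(Φ ∘ φ⁻¹))² = 4 s ω'(s)²` (`gradSq_of_flatOn`);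
* `Δ_g Φ = Σᵢ ∂ᵢ∂ᵢ(Φ ∘ φ⁻¹) = 8 ω'(s) + 4 s ω''(s)` (`dalembertian_of_flatOn`; the tree's
  `dalembertian = tr_g Hess` is `+Σ ∂ᵢ²` in flat coordinates),

the Euclidean derivatives of the radial function being
`D(ω(‖· − y₀‖²))_z = 2 ω'(s) ⟨z − y₀, ·⟩` and
`D²(ω(‖· − y₀‖²))_y (v, w) = 2 ω'(s) ⟪v, w⟫ + 4 ω''(s) ⟪y − y₀, v⟫ ⟪y − y₀, w⟫`.
The flatness clause of the statement (through `dφ⁻¹`) is converted to the form of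
`Literature/Geometry/Lorentzian/FlatChartComputations.lean` (through `dφ`) by `dφ ∘ dφ⁻¹ = id`
(`MaxAtlasChart.mfderiv_chart_comp_inv_apply`). Everything is proved; no definition, no named
fact.

References: B. O'Neill, *Semi-Riemannian geometry with applications to relativity* (1983),
Ch. 3, Prop. 3.13, Lemma 3.38, Def. 3.50, Prop. 3.59 and pp. 90–91 [ONeill1983].
-/

noncomputable section

open scoped Manifold ContDiff Topology RealInnerProductSpace
open Set Filter
open Literature.Geometry.Lorentzian Literature.Geometry.Riemannian

-- the registered namespace `Summit.SmoothPoincare4.SmoothPoincare4.Theorems` repeats a component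
set_option linter.dupNamespace false

namespace Summit.SmoothPoincare4.SmoothPoincare4.Theorems

namespace HelperFlatChartRadialAux

section Euclidean

variable {E : Type*} [NormedAddCommGroup E] [InnerProductSpace ℝ E]

/-- The differential of the radial function `w ↦ ω(‖w − y₀‖²)`:
`2 ω'(‖z − y₀‖²) ⟨z − y₀, ·⟩`. [folklore] -/
theorem hasFDerivAt_radial {prof : ℝ → ℝ} (hprof : ContDiff ℝ ∞ prof) (y₀ z : E) :
    HasFDerivAt (fun w : E ↦ prof (‖w - y₀‖ ^ 2))
      ((2 * deriv prof (‖z - y₀‖ ^ 2)) • innerSL ℝ (z - y₀)) z := by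
  have h1 : HasFDerivAt (fun w : E ↦ ‖w - y₀‖ ^ 2) ((2 : ℝ) • innerSL ℝ (z - y₀)) z := by
    refine (((hasFDerivAt_id z).sub_const y₀).norm_sq).congr_fderiv ?_
    ext v
    simp [two_smul]
  have h2 : HasDerivAt prof (deriv prof (‖z - y₀‖ ^ 2)) (‖z - y₀‖ ^ 2) :=
    ((hprof.differentiable (by simp)) _).hasDerivAt
  have h3 := h2.comp_hasFDerivAt z h1
  rw [smul_smul, mul_comm] at h3
  exact h3

/-- `D(ω(‖· − y₀‖²)) = z ↦ 2 ω'(‖z − y₀‖²) ⟨z − y₀, ·⟩`. [folklore] -/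
theorem fderiv_radial {prof : ℝ → ℝ} (hprof : ContDiff ℝ ∞ prof) (y₀ : E) :
    fderiv ℝ (fun w : E ↦ prof (‖w - y₀‖ ^ 2)) =
      fun z ↦ (2 * deriv prof (‖z - y₀‖ ^ 2)) • innerSL ℝ (z - y₀) :=
  funext fun z ↦ (hasFDerivAt_radial hprof y₀ z).fderiv

/-- The second differential of the radial function:
`D²(ω(‖· − y₀‖²))_y (v, w) = 2 ω'(s) ⟪v, w⟫ + 4 ω''(s) ⟪y − y₀, v⟫ ⟪y − y₀, w⟫`, `s = ‖y − y₀‖²`.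
[folklore] -/
theorem fderiv_fderiv_radial_apply {prof : ℝ → ℝ} (hprof : ContDiff ℝ ∞ prof) (y₀ y v w : E) :
    fderiv ℝ (fderiv ℝ (fun w : E ↦ prof (‖w - y₀‖ ^ 2))) y v w =
      2 * deriv prof (‖y - y₀‖ ^ 2) * ⟪v, w⟫ +
        4 * deriv (deriv prof) (‖y - y₀‖ ^ 2) * ⟪y - y₀, v⟫ * ⟪y - y₀, w⟫ := by
  have hprof' : ContDiff ℝ ∞ (deriv prof) := (contDiff_infty_iff_deriv.mp hprof).2
  -- the scalar factor `c z = 2 ω'(‖z − y₀‖²)` and its differential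
  have hc : HasFDerivAt (fun z : E ↦ 2 * deriv prof (‖z - y₀‖ ^ 2))
      ((2 : ℝ) • ((2 * deriv (deriv prof) (‖y - y₀‖ ^ 2)) • innerSL ℝ (y - y₀))) y :=
    (hasFDerivAt_radial hprof' y₀ y).const_mul 2
  -- the covector factor `L z = ⟨z − y₀, ·⟩` and its differential
  have hL : HasFDerivAt (fun z : E ↦ innerSL ℝ (z - y₀))
      (innerSL ℝ : E →L[ℝ] E →L[ℝ] ℝ) y := by
    have h : HasFDerivAt (fun z : E ↦ innerSL ℝ (z - y₀))
        ((innerSL ℝ : E →L[ℝ] E →L[ℝ] ℝ).comp (ContinuousLinearMap.id ℝ E)) y :=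
      ((innerSL ℝ : E →L[ℝ] E →L[ℝ] ℝ).hasFDerivAt).comp y ((hasFDerivAt_id y).sub_const y₀)
    rwa [ContinuousLinearMap.comp_id] at h
  have key : ∀ a b : E, (innerSL ℝ : E →L[ℝ] E →L[ℝ] ℝ) a b = ⟪a, b⟫ := fun a b ↦ rfl
  have h := hc.smul hL
  rw [fderiv_radial hprof y₀]
  change fderiv ℝ ((fun z : E ↦ 2 * deriv prof (‖z - y₀‖ ^ 2)) • fun z : E ↦ innerSL ℝ (z - y₀))
    y v w = _
  rw [h.fderiv]
  simp only [FunLike.coe_add, Pi.add_apply, FunLike.coe_smul, Pi.smul_apply,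
    ContinuousLinearMap.smulRight_apply, key, smul_eq_mul]
  ring

end Euclidean

section Four

/-- `Σᵢ (∂ᵢ ω(‖· − y₀‖²))(y)² = 4 s ω'(s)²` on `ℝ⁴`, `s = ‖y − y₀‖²`. [folklore] -/
theorem sum_sq_fderiv_radial {prof : ℝ → ℝ} (hprof : ContDiff ℝ ∞ prof)
    (y₀ y : EuclideanSpace ℝ (Fin 4)) :
    ∑ i, (fderiv ℝ (fun w : EuclideanSpace ℝ (Fin 4) ↦ prof (‖w - y₀‖ ^ 2)) y
        (EuclideanSpace.single i 1)) ^ 2 =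
      4 * ‖y - y₀‖ ^ 2 * (deriv prof (‖y - y₀‖ ^ 2)) ^ 2 := by
  rw [fderiv_radial hprof y₀]
  simp only [FunLike.coe_smul, Pi.smul_apply, innerSL_apply_apply,
    EuclideanSpace.inner_single_right, smul_eq_mul, conj_trivial, one_mul]
  rw [EuclideanSpace.real_norm_sq_eq, Finset.mul_sum, Finset.sum_mul]
  exact Finset.sum_congr rfl fun i _ ↦ by ring

/-- `Σᵢ ∂ᵢ∂ᵢ (ω(‖· − y₀‖²))(y) = 8 ω'(s) + 4 s ω''(s)` on `ℝ⁴`, `s = ‖y − y₀‖²`. [folklore] -/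
theorem sum_fderiv_fderiv_radial {prof : ℝ → ℝ} (hprof : ContDiff ℝ ∞ prof)
    (y₀ y : EuclideanSpace ℝ (Fin 4)) :
    ∑ i, fderiv ℝ (fderiv ℝ (fun w : EuclideanSpace ℝ (Fin 4) ↦ prof (‖w - y₀‖ ^ 2))) y
        (EuclideanSpace.single i 1) (EuclideanSpace.single i 1) =
      8 * deriv prof (‖y - y₀‖ ^ 2)
        + 4 * ‖y - y₀‖ ^ 2 * deriv (deriv prof) (‖y - y₀‖ ^ 2) := by
  have h1 : ∀ i : Fin 4, ⟪(EuclideanSpace.single i (1 : ℝ) : EuclideanSpace ℝ (Fin 4)),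
      EuclideanSpace.single i (1 : ℝ)⟫ = 1 := fun i ↦ by
    rw [EuclideanSpace.inner_single_left, conj_trivial, one_mul, PiLp.single_apply, if_pos rfl]
  have h2 : ∀ i : Fin 4, ⟪y - y₀, EuclideanSpace.single i (1 : ℝ)⟫ = (y - y₀) i := fun i ↦ by
    rw [EuclideanSpace.inner_single_right, conj_trivial, one_mul]
  simp only [fderiv_fderiv_radial_apply hprof, h1, h2, mul_one]
  have h3 : ∑ i : Fin 4, 4 * deriv (deriv prof) (‖y - y₀‖ ^ 2) * (y - y₀) i * (y - y₀) i =
      ∑ i : Fin 4, 4 * (y - y₀) i ^ 2 * deriv (deriv prof) (‖y - y₀‖ ^ 2) :=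
    Finset.sum_congr rfl fun i _ ↦ by ring
  rw [Finset.sum_add_distrib, Finset.sum_const, Finset.card_univ, Fintype.card_fin, h3,
    EuclideanSpace.real_norm_sq_eq, Finset.mul_sum, Finset.sum_mul, nsmul_eq_mul]
  push_cast
  ring

end Four

section Chart

variable {M : Type*} [TopologicalSpace M] [ChartedSpace (EuclideanSpace ℝ (Fin 4)) M]

/-- For the boundaryless model `𝓡 4` the extended chart is the chart. [folklore] -/
theorem extChartAt_eq_chartAt (p : M) :
    extChartAt (𝓡 4) p = (chartAt (EuclideanSpace ℝ (Fin 4)) p).toPartialEquiv := by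
  rw [extChartAt, OpenPartialHomeomorph.extend, modelWithCornersSelf_partialEquiv,
    PartialEquiv.trans_refl]

variable [IsManifold (𝓡 4) ∞ M]

/-- Flatness read through the inverse chart (`g(de⁻¹ X, de⁻¹ W) = ⟪X, W⟫`) is flatness read
through the chart (`g(v, w) = ⟪de v, de w⟫`), `de⁻¹` being onto with `de ∘ de⁻¹ = id`.
[cite: ONeill1983, Ch. 3, pp. 90–91] -/
theorem flat_pushforward
    (g : PseudoRiemannianMetric (𝓡 4) ∞ (EuclideanSpace ℝ (Fin 4)) (TangentSpace (𝓡 4) : M → Type _))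
    {e : OpenPartialHomeomorph M (EuclideanSpace ℝ (Fin 4))}
    (he : e ∈ IsManifold.maximalAtlas (𝓡 4) ∞ M) {y : EuclideanSpace ℝ (Fin 4)} (hy : y ∈ e.target)
    (hflat : ∀ X W : EuclideanSpace ℝ (Fin 4),
      g.val (e.symm y) (mfderiv 𝓘(ℝ, EuclideanSpace ℝ (Fin 4)) (𝓡 4) e.symm y X)
        (mfderiv 𝓘(ℝ, EuclideanSpace ℝ (Fin 4)) (𝓡 4) e.symm y W) = ⟪X, W⟫)
    (v w : TangentSpace (𝓡 4) (e.symm y)) :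
    g.val (e.symm y) v w = (euclideanMetric (EuclideanSpace ℝ (Fin 4))).val y
      (mfderiv (𝓡 4) (𝓡 4) e (e.symm y) v) (mfderiv (𝓡 4) (𝓡 4) e (e.symm y) w) := by
  have hsurj : Function.Surjective
      (mfderiv 𝓘(ℝ, EuclideanSpace ℝ (Fin 4)) (𝓡 4) e.symm y) :=
    (MaxAtlasChart.mdifferentiable_chart he).symm.mfderiv_surjective hy
  obtain ⟨X, rfl⟩ := hsurj v
  obtain ⟨W, rfl⟩ := hsurj w
  have hinv : ∀ a : EuclideanSpace ℝ (Fin 4), mfderiv (𝓡 4) (𝓡 4) e (e.symm y)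
      (mfderiv 𝓘(ℝ, EuclideanSpace ℝ (Fin 4)) (𝓡 4) e.symm y a) = a := fun a ↦ by
    have h := MaxAtlasChart.mfderiv_chart_comp_inv_apply he ⟨y, hy⟩ a
    rwa [MaxAtlasChart.mfderiv_inv he, MaxAtlasChart.inv_apply] at h
  rw [hflat, euclideanMetric_apply, hinv X, hinv W]
  rfl

omit [IsManifold (𝓡 4) ∞ M] in
/-- A function whose chart representative is a smooth Euclidean function on an open set
`B ⊆ e.target` is smooth at the points `e⁻¹ z`, `z ∈ B`. [folklore] -/
theorem contMDiffAt_of_comp_symm {e : OpenPartialHomeomorph M (EuclideanSpace ℝ (Fin 4))}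
    (he : e ∈ IsManifold.maximalAtlas (𝓡 4) ∞ M) {B : Set (EuclideanSpace ℝ (Fin 4))}
    (hBo : IsOpen B) (hBe : B ⊆ e.target) {Φ : M → ℝ} {P : EuclideanSpace ℝ (Fin 4) → ℝ}
    (hP : ContDiff ℝ ∞ P) (hΦ : ∀ z ∈ B, Φ (e.symm z) = P z) {y : EuclideanSpace ℝ (Fin 4)}
    (hy : y ∈ B) : ContMDiffAt (𝓡 4) 𝓘(ℝ, ℝ) ∞ Φ (e.symm y) := by
  have hys : e.symm y ∈ e.source := e.map_target (hBe hy)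
  have hev : Φ =ᶠ[𝓝 (e.symm y)] P ∘ e := by
    have hU : e.source ∩ e ⁻¹' B ∈ 𝓝 (e.symm y) :=
      (e.isOpen_inter_preimage hBo).mem_nhds ⟨hys, by rw [mem_preimage, e.right_inv (hBe hy)]; exact hy⟩
    filter_upwards [hU] with x hx
    have h := hΦ (e x) hx.2
    rwa [e.left_inv hx.1] at h
  have h1 : ContMDiffAt 𝓘(ℝ, EuclideanSpace ℝ (Fin 4)) 𝓘(ℝ, ℝ) ∞ P (e (e.symm y)) :=
    hP.contDiffAt.contMDiffAt
  have h2 : ContMDiffAt (𝓡 4) (𝓡 4) ∞ e (e.symm y) :=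
    (contMDiffOn_of_mem_maximalAtlas he).contMDiffAt (e.open_source.mem_nhds hys)
  exact (h1.comp (e.symm y) h2).congr_of_eventuallyEq hev

/-- **Radial calculus in a flat chart of the maximal atlas** (workhorse): `R_g = 0`,
`|∇Φ|²_g = 4 s ω'(s)²`, `Δ_g Φ = 8 ω'(s) + 4 s ω''(s)` at `e⁻¹ y`, `s = ‖y − y₀‖²`, for `g`
Euclidean in `e` on `closedBall y₀ r` and `Φ ∘ e⁻¹ = ω(‖· − y₀‖²)` on `ball y₀ r`.
[cite: ONeill1983, Ch. 3, Prop. 3.13, Lemma 3.38 and Def. 3.50] -/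
theorem radial_of_flat
    (g : PseudoRiemannianMetric (𝓡 4) ∞ (EuclideanSpace ℝ (Fin 4)) (TangentSpace (𝓡 4) : M → Type _))
    [g.HasLeviCivita] {e : OpenPartialHomeomorph M (EuclideanSpace ℝ (Fin 4))}
    (he : e ∈ IsManifold.maximalAtlas (𝓡 4) ∞ M) {y₀ : EuclideanSpace ℝ (Fin 4)} {r : ℝ}
    (Φ : M → ℝ) {prof : ℝ → ℝ}
    (hB : Metric.closedBall y₀ r ⊆ e.target)
    (hflat : ∀ y ∈ Metric.closedBall y₀ r, ∀ X W : EuclideanSpace ℝ (Fin 4),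
      g.val (e.symm y) (mfderiv 𝓘(ℝ, EuclideanSpace ℝ (Fin 4)) (𝓡 4) e.symm y X)
        (mfderiv 𝓘(ℝ, EuclideanSpace ℝ (Fin 4)) (𝓡 4) e.symm y W) = ⟪X, W⟫)
    (hprof : ContDiff ℝ ∞ prof)
    (hΦ : ∀ y ∈ Metric.ball y₀ r, Φ (e.symm y) = prof (‖y - y₀‖ ^ 2))
    {y : EuclideanSpace ℝ (Fin 4)} (hy : y ∈ Metric.ball y₀ r) :
    g.scalarCurvature (e.symm y) = 0 ∧
      g.gradSq Φ (e.symm y) = 4 * ‖y - y₀‖ ^ 2 * (deriv prof (‖y - y₀‖ ^ 2)) ^ 2 ∧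
      g.dalembertian Φ (e.symm y) =
        8 * deriv prof (‖y - y₀‖ ^ 2) + 4 * ‖y - y₀‖ ^ 2 * deriv (deriv prof) (‖y - y₀‖ ^ 2) := by
  have hBo : Metric.ball y₀ r ⊆ e.target := Metric.ball_subset_closedBall.trans hB
  have hflat' : ∀ z ∈ Metric.ball y₀ r, ∀ v w, g.val (e.symm z) v w =
      (euclideanMetric (EuclideanSpace ℝ (Fin 4))).val z
        (mfderiv (𝓡 4) (𝓡 4) e (e.symm z) v) (mfderiv (𝓡 4) (𝓡 4) e (e.symm z) w) :=
    fun z hz v w ↦ flat_pushforward g he (hBo hz) (hflat z (Metric.ball_subset_closedBall hz)) v w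
  have hev : Φ ∘ e.symm =ᶠ[𝓝 y] fun w ↦ prof (‖w - y₀‖ ^ 2) := by
    filter_upwards [Metric.isOpen_ball.mem_nhds hy] with z hz using hΦ z hz
  have hP : ContDiff ℝ ∞ fun w : EuclideanSpace ℝ (Fin 4) ↦ prof (‖w - y₀‖ ^ 2) :=
    hprof.comp ((contDiff_id.sub contDiff_const).norm_sq ℝ)
  have hΦs : ContMDiffAt (𝓡 4) 𝓘(ℝ, ℝ) ∞ Φ (e.symm y) :=
    contMDiffAt_of_comp_symm he Metric.isOpen_ball hBo hP hΦ hy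
  refine ⟨scalarCurvature_of_flatOn g he Metric.isOpen_ball hBo hflat' hy, ?_, ?_⟩
  · rw [gradSq_of_flatOn g he Metric.isOpen_ball hBo hflat' hy
      (hΦs.mdifferentiableAt (by simp)), hev.fderiv_eq]
    exact sum_sq_fderiv_radial hprof y₀ y
  · rw [dalembertian_of_flatOn g he Metric.isOpen_ball hBo hflat' hy (hΦs.of_le (by norm_cast)),
      hev.fderiv.fderiv_eq]
    exact sum_fderiv_fderiv_radial hprof y₀ y

end Chart

end HelperFlatChartRadialAux

/-- **W6 — radial calculus in a flat chart** (registered helper stub `helper_flatChartRadial` of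
line `fat-conical-core-avr-logsobolev`): for `g` Euclidean in the chart `φ = extChartAt (𝓡 4) p`
on `closedBall (φ p) r ⊆ φ.target` and `Φ ∘ φ⁻¹ = ω(‖· − φ p‖²)` on the open ball, at `φ⁻¹ y`
(`y` in the open ball, `s = ‖y − φ p‖²`): `R_g = 0`, `|∇Φ|²_g = 4 s ω'(s)²` and
`Δ_g Φ = 8 ω'(s) + 4 s ω''(s)` (`HelperFlatChartRadialAux.radial_of_flat` for the chart
`chartAt _ p = extChartAt (𝓡 4) p` of the maximal atlas). The hypothesis `0 < r` is not used.
[cite: ONeill1983, Ch. 3, Prop. 3.13, Lemma 3.38 and Def. 3.50] -/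
theorem helper_flatChartRadial :
    ∀ (M : Type) [TopologicalSpace M] [T2Space M] [SecondCountableTopology M]
      [ChartedSpace (EuclideanSpace ℝ (Fin 4)) M] [IsManifold (𝓡 4) ∞ M]
      (g : PseudoRiemannianMetric (𝓡 4) ∞ (EuclideanSpace ℝ (Fin 4)) (TangentSpace (𝓡 4) : M → Type _))
      [g.HasLeviCivita] (p : M) (r : ℝ) (Φ : M → ℝ) (prof : ℝ → ℝ),
      0 < r →
      (Metric.closedBall (extChartAt (𝓡 4) p p) r ⊆ (extChartAt (𝓡 4) p).target ∧
        ∀ y ∈ Metric.closedBall (extChartAt (𝓡 4) p p) r, ∀ X W : EuclideanSpace ℝ (Fin 4),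
          g.val ((extChartAt (𝓡 4) p).symm y)
            (mfderiv 𝓘(ℝ, EuclideanSpace ℝ (Fin 4)) (𝓡 4) (extChartAt (𝓡 4) p).symm y X)
            (mfderiv 𝓘(ℝ, EuclideanSpace ℝ (Fin 4)) (𝓡 4) (extChartAt (𝓡 4) p).symm y W) = ⟪X, W⟫) →
      ContDiff ℝ ∞ prof →
      (∀ y ∈ Metric.ball (extChartAt (𝓡 4) p p) r,
        Φ ((extChartAt (𝓡 4) p).symm y) = prof (‖y - extChartAt (𝓡 4) p p‖ ^ 2)) →
      ∀ y ∈ Metric.ball (extChartAt (𝓡 4) p p) r,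
        g.scalarCurvature ((extChartAt (𝓡 4) p).symm y) = 0 ∧
        g.gradSq Φ ((extChartAt (𝓡 4) p).symm y) =
          4 * ‖y - extChartAt (𝓡 4) p p‖ ^ 2 * (deriv prof (‖y - extChartAt (𝓡 4) p p‖ ^ 2)) ^ 2 ∧
        g.dalembertian Φ ((extChartAt (𝓡 4) p).symm y) =
          8 * deriv prof (‖y - extChartAt (𝓡 4) p p‖ ^ 2)
            + 4 * ‖y - extChartAt (𝓡 4) p p‖ ^ 2 * deriv (deriv prof) (‖y - extChartAt (𝓡 4) p p‖ ^ 2) := by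
  intro M _ _ _ _ _ g _ p r Φ prof _ hflat hprof hΦ y hy
  have hφ := HelperFlatChartRadialAux.extChartAt_eq_chartAt (M := M) p
  rw [hφ] at hflat hΦ hy ⊢
  simp only [OpenPartialHomeomorph.coe_toPartialEquiv, OpenPartialHomeomorph.coe_toPartialEquiv_symm]
    at hflat hΦ hy ⊢
  exact HelperFlatChartRadialAux.radial_of_flat g (IsManifold.chart_mem_maximalAtlas p) Φ
    hflat.1 hflat.2 hprof hΦ hy

end Summit.SmoothPoincare4.SmoothPoincare4.Theorems

end
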